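import Literature.MathematicalPhysics.QuantumLattice.HeatKernelGroupConvolutionProofs
import HarnessLib

/-!
# The heat semigroup of a compact group on `L²`: compactness, symmetry, spectral structure

Second brick of the proof of
`Literature.MathematicalPhysics.QuantumLattice.isGroupHeatKernel_unique_up_to_scale` (Hunt 1956,
Thm 5.1 with Schur's lemma), continuing `HeatKernelGroupConvolutionProofs`.

For a continuous kernel `k` on a compact group `G` (Haar probability measure `μ`):

* `convToCM hk : L²(G) →L[ℝ] C(G, ℝ)`, `f ↦ k ⋆ f`, with `‖k ⋆ f‖_∞ ≤ (sup|k|) ∫|f| ≤ (sup|k|) ‖f‖₂`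
  (`integral_abs_le_norm_L2`), and **compact** (`isCompactOperator_convToCM`: Arzelà–Ascoli,
  equicontinuity from `exists_nhds_one_forall_abs_haarConv_sub_le`);
* `convL2 hk = toLp ∘ convToCM hk : L²(G) →L[ℝ] L²(G)`, compact, and **symmetric** for a
  symmetric kernel (`convL2_isSymmetric`: density of `C(G)` in `L²`, `integral_haarConv_mul_eq`).

For a heat kernel `p` (`IsGroupHeatKernel p`) the heat operators `T_t = hp.opL2 ht` (`t > 0`)
are therefore compact symmetric operators on `L²(G)` with

* the semigroup law `T_s T_t = T_{s+t}` (`opL2_comp`) and commutation with the operators of any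
  other heat kernel of `G` (`opL2_comm`, central kernels commute);
* positivity `⟪T_t f, f⟫ = ‖T_{t/2} f‖²` (`inner_opL2_self`);
* the approximate identity `T_{tₙ} u → u` in `L²` for continuous `u`, `tₙ → 0⁺`
  (`tendsto_opL2_toLp`), hence **injectivity** of every `T_t` (`opL2_injective`);
* eigenvectors with non-zero eigenvalue have continuous representatives
  (`exists_toLp_eq_of_eigen`).

**Spectral structure** (Mathlib's spectral theorem for compact self-adjoint operators,
`ContinuousLinearMap.orthogonalComplement_iSup_eigenspaces_eq_bot`): the eigenspaces
`E_c = hp.eig c` of `T_1` are finite-dimensional for `c ≠ 0`, `E_0 = ⊥`, eigenvalues are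
positive (`eigenvalue_pos`), their span is dense (`iSup_eig_dense`), and on `E_c`
**`T_t = c^t` for all real `t > 0`** (`opL2_eq_smul_of_mem_eig`: uniqueness of positive square
roots `opL2_half_eq_smul`, dyadic times, and approximation from above via the approximate
identity). For a second heat kernel `q` of `G` the operators commute, `E_c` is spanned by joint
eigenvectors (`eig_le_iSup_inf_eig`), and the joint eigenvectors span a dense subspace of `L²(G)`
(`iSup_inf_eig_dense`) on which `T^p_t = c^t`, `T^q_s = d^s` (`opL2_eq_smul_of_mem_inf_eig`).
This is the "Peter–Weyl from the heat kernel" input for the generating functionals (next bricks).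

Sources: E. M. Stein, *Topics in Harmonic Analysis* (1970), Ch. II §2; standard (Folland,
*A Course in Abstract Harmonic Analysis*, §5.2). No named facts; the definitions `convToCM`,
`convL2`, `IsGroupHeatKernel.opL2`, `IsGroupHeatKernel.eig` are bounded operators / eigenspaces
built from `haarConv`, and the instance `haarProbability.instRegular` only exposes
`regular_haarMeasure` through the definition.
-/

open MeasureTheory Filter Topology
open Literature.MathematicalPhysics.QuantumFieldTheory (haarProbability)

noncomputable section

namespace Literature.MathematicalPhysics.QuantumLattice

variable {G : Type*} [Group G] [TopologicalSpace G] [IsTopologicalGroup G] [CompactSpace G]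
  [MeasurableSpace G] [BorelSpace G]


section L2Operator

open scoped InnerProductSpace

/-- The Haar probability measure of a compact group is regular (it is `haarMeasure ⊤`). [folklore] -/
instance _root_.Literature.MathematicalPhysics.QuantumFieldTheory.haarProbability.instRegular :
    (haarProbability G).Regular := by
  rw [haarProbability]; infer_instance

/-- On a probability space, `∫ |f| ≤ ‖f‖_{L²}` for `f ∈ L²` (monotonicity of `L^p` norms).
[folklore] -/
theorem integral_abs_le_norm_L2 (f : Lp ℝ 2 (haarProbability G)) :
    ∫ x, |f x| ∂(haarProbability G) ≤ ‖f‖ := by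
  have hf := Lp.aestronglyMeasurable f
  have h1 : ∫ x, |f x| ∂(haarProbability G) = (eLpNorm f 1 (haarProbability G)).toReal := by
    rw [eLpNorm_one_eq_lintegral_enorm, ← integral_norm_eq_lintegral_enorm hf]
    simp only [Real.norm_eq_abs]
  rw [h1, Lp.norm_def]
  exact ENNReal.toReal_mono (Lp.eLpNorm_ne_top f)
    (eLpNorm_le_eLpNorm_of_exponent_le one_le_two hf)

/-- An `L²` function on the compact group is integrable (finite measure). [folklore] -/
theorem integrable_of_L2 (f : Lp ℝ 2 (haarProbability G)) : Integrable f (haarProbability G) :=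
  (Lp.memLp f).integrable one_le_two

/-- `haarConv k` respects almost-everywhere equality in its second argument (second convolution
formula: the integration variable enters `f` directly). [folklore] -/
theorem haarConv_congr_ae (k : G → ℝ) {f g : G → ℝ} (h : f =ᵐ[haarProbability G] g) :
    haarConv k f = haarConv k g := by
  funext x
  rw [haarConv_eq_integral_mul_inv, haarConv_eq_integral_mul_inv]
  refine integral_congr_ae ?_
  filter_upwards [h] with y hy
  rw [hy]

/-- **The smoothing operator `S_k : L²(G) → C(G, ℝ)`, `f ↦ k ⋆ f`**, for a continuous kernel `k`
on a compact (Hausdorff) group: linear, and bounded by `‖k ⋆ f‖_∞ ≤ (sup |k|) ∫|f| ≤ (sup |k|) ‖f‖₂`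
(Stein 1970, Ch. II §2: the heat operators map `L²` into continuous functions). [folklore] -/
def convToCM {k : G → ℝ} (hk : Continuous k) : Lp ℝ 2 (haarProbability G) →L[ℝ] C(G, ℝ) :=
  LinearMap.mkContinuousOfExistsBound
    { toFun := fun f => ⟨haarConv k f, continuous_haarConv hk (integrable_of_L2 f)⟩
      map_add' := fun f g => by
        ext x
        simp only [ContinuousMap.coe_mk, ContinuousMap.add_apply]
        rw [haarConv_congr_ae k (Lp.coeFn_add f g), haarConv_eq_integral_mul_inv,
          haarConv_eq_integral_mul_inv, haarConv_eq_integral_mul_inv, ← integral_add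
          (integrable_mul_inv_mul hk (integrable_of_L2 f) x)
          (integrable_mul_inv_mul hk (integrable_of_L2 g) x)]
        refine integral_congr_ae (Eventually.of_forall fun y => ?_)
        simp only [Pi.add_apply, mul_add]
      map_smul' := fun c f => by
        ext x
        simp only [ContinuousMap.coe_mk, ContinuousMap.smul_apply, RingHom.id_apply, smul_eq_mul]
        rw [haarConv_congr_ae k (Lp.coeFn_smul c f), haarConv_eq_integral_mul_inv,
          haarConv_eq_integral_mul_inv, ← integral_const_mul]
        refine integral_congr_ae (Eventually.of_forall fun y => ?_)
        simp only [Pi.smul_apply, smul_eq_mul]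
        ring }
    (by
      obtain ⟨C, hC0, hC⟩ := exists_forall_abs_le_of_continuous hk
      refine ⟨C, fun f => ?_⟩
      rw [ContinuousMap.norm_le _ (by positivity)]
      intro x
      simp only [LinearMap.coe_mk, AddHom.coe_mk, ContinuousMap.coe_mk, Real.norm_eq_abs]
      exact (abs_haarConv_le hC (integrable_of_L2 f) x).trans
        (mul_le_mul_of_nonneg_left (integral_abs_le_norm_L2 f) hC0))

/-- `S_k f = k ⋆ f` as functions. [folklore] -/
@[simp]
theorem convToCM_apply {k : G → ℝ} (hk : Continuous k) (f : Lp ℝ 2 (haarProbability G)) (x : G) :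
    convToCM hk f x = haarConv k f x := rfl

/-- On continuous functions, `S_k (toLp u) = k ⋆ u` (the `L²` class of `u` is a.e. `u`). [folklore] -/
theorem convToCM_toLp {k : G → ℝ} (hk : Continuous k) (u : C(G, ℝ)) (x : G) :
    convToCM hk (ContinuousMap.toLp 2 (haarProbability G) ℝ u) x = haarConv k u x := by
  rw [convToCM_apply, haarConv_congr_ae k (ContinuousMap.coeFn_toLp (haarProbability G) u)]

/-- Sup bound `|S_k f (x)| ≤ (sup |k|) ‖f‖₂`. [folklore] -/
theorem abs_convToCM_le {k : G → ℝ} (hk : Continuous k) {C : ℝ} (hC0 : 0 ≤ C) (hC : ∀ x, |k x| ≤ C)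
    (f : Lp ℝ 2 (haarProbability G)) (x : G) : |convToCM hk f x| ≤ C * ‖f‖ :=
  (abs_haarConv_le hC (integrable_of_L2 f) x).trans
    (mul_le_mul_of_nonneg_left (integral_abs_le_norm_L2 f) hC0)

/-- **`S_k` is a compact operator** `L²(G) → C(G, ℝ)` (Arzelà–Ascoli: the image of the unit ball
is bounded by `sup |k|` and equicontinuous by `exists_nhds_one_forall_abs_haarConv_sub_le` and
`∫|f| ≤ ‖f‖₂ ≤ 1`). [folklore] -/
theorem isCompactOperator_convToCM {k : G → ℝ} (hk : Continuous k) :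
    IsCompactOperator (convToCM (G := G) hk) := by
  refine (isCompactOperator_iff_isCompact_closure_image_closedBall
    (convToCM hk).toLinearMap zero_lt_one).mpr ?_
  obtain ⟨C, hC0, hC⟩ := exists_forall_abs_le_of_continuous hk
  -- transfer to bounded continuous functions, where Arzelà–Ascoli is available
  let e := ContinuousMap.isometryEquivBoundedOfCompact G ℝ
  have hAB : ∀ F ∈ e '' ((convToCM hk).toLinearMap '' Metric.closedBall 0 1),
      ∃ f : Lp ℝ 2 (haarProbability G), ‖f‖ ≤ 1 ∧ ∀ x, F x = haarConv k f x := by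
    rintro F ⟨u, ⟨f, hf, rfl⟩, rfl⟩
    exact ⟨f, by simpa using hf, fun x => rfl⟩
  have hcomp : IsCompact (closure (e '' ((convToCM hk).toLinearMap '' Metric.closedBall 0 1))) := by
    refine BoundedContinuousFunction.arzela_ascoli (Metric.closedBall (0 : ℝ) C)
      (isCompact_closedBall 0 C) _ ?_ ?_
    · intro F x hF
      obtain ⟨f, hf1, hF⟩ := hAB F hF
      rw [Metric.mem_closedBall, dist_zero_right, Real.norm_eq_abs, hF x]
      calc |haarConv k f x| ≤ C * ‖f‖ := abs_convToCM_le hk hC0 hC f x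
        _ ≤ C * 1 := by gcongr
        _ = C := mul_one C
    · intro x₀
      rw [Metric.equicontinuousAt_iff_right]
      intro ε hε
      obtain ⟨U, hU, hUf⟩ := exists_nhds_one_forall_abs_haarConv_sub_le hk (half_pos hε)
      have hmap : Tendsto (fun x => x * x₀⁻¹) (𝓝 x₀) (𝓝 1) := by
        have : Continuous fun x : G => x * x₀⁻¹ := by fun_prop
        simpa using this.tendsto x₀
      filter_upwards [hmap hU] with x hx
      rintro ⟨F, hF⟩
      obtain ⟨f, hf1, hFf⟩ := hAB F hF
      simp only [hFf]
      rw [Real.dist_eq, abs_sub_comm]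
      have key := hUf f (integrable_of_L2 f) (x * x₀⁻¹) hx x₀
      rw [inv_mul_cancel_right] at key
      refine key.trans_lt ?_
      calc ε / 2 * ∫ h, |f h| ∂haarProbability G ≤ ε / 2 * 1 := by
            gcongr
            exact (integral_abs_le_norm_L2 f).trans hf1
        _ < ε := by linarith
  rw [show (⇑e '' ((convToCM hk).toLinearMap '' Metric.closedBall 0 1)) =
      e.toHomeomorph '' ((convToCM hk).toLinearMap '' Metric.closedBall 0 1) from rfl,
    ← e.toHomeomorph.image_closure] at hcomp
  exact e.toHomeomorph.isCompact_image.mp hcomp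

/-- **The convolution operator `T_k = toLp ∘ S_k` on `L²(G)`** for a continuous kernel `k`:
`T_k f = k ⋆ f` viewed back in `L²` (Stein 1970, Ch. II §2). [folklore] -/
def convL2 {k : G → ℝ} (hk : Continuous k) :
    Lp ℝ 2 (haarProbability G) →L[ℝ] Lp ℝ 2 (haarProbability G) :=
  (ContinuousMap.toLp 2 (haarProbability G) ℝ).comp (convToCM hk)

/-- Unfolding `T_k = toLp ∘ S_k`. [folklore] -/
theorem convL2_apply {k : G → ℝ} (hk : Continuous k) (f : Lp ℝ 2 (haarProbability G)) :
    convL2 hk f = ContinuousMap.toLp 2 (haarProbability G) ℝ (convToCM hk f) := rfl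

/-- `T_k` is a compact operator on `L²(G)` (`S_k` compact, `toLp` bounded). [folklore] -/
theorem isCompactOperator_convL2 {k : G → ℝ} (hk : Continuous k) :
    IsCompactOperator (convL2 (G := G) hk) := by
  have h := (isCompactOperator_convToCM hk).clm_comp
    (ContinuousMap.toLp (E := ℝ) 2 (haarProbability G) ℝ)
  exact h

/-- `T_k (toLp u) = toLp (k ⋆ u)` for continuous `u`. [folklore] -/
theorem convL2_toLp {k : G → ℝ} (hk : Continuous k) (u : C(G, ℝ)) :
    convL2 hk (ContinuousMap.toLp 2 (haarProbability G) ℝ u) =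
      ContinuousMap.toLp 2 (haarProbability G) ℝ
        ⟨haarConv k u, continuous_haarConv hk (u.continuous.integrable_of_hasCompactSupport
          (HasCompactSupport.of_compactSpace _))⟩ := by
  rw [convL2_apply]
  congr 1
  ext x
  exact convToCM_toLp hk u x

/-- The continuous functions are dense in `L²(G)` (Haar probability measure is weakly regular,
`G` compact Hausdorff hence normal). [folklore] -/
theorem denseRange_toLp [T2Space G] :
    DenseRange (ContinuousMap.toLp 2 (haarProbability G) ℝ : C(G, ℝ) →L[ℝ] Lp ℝ 2 (haarProbability G)) :=
  ContinuousMap.toLp_denseRange ℝ (haarProbability G) ℝ ENNReal.ofNat_ne_top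

/-- The `L²` pairing of two continuous functions is the Haar integral of their product. [folklore] -/
theorem inner_toLp_toLp (u v : C(G, ℝ)) :
    ⟪ContinuousMap.toLp 2 (haarProbability G) ℝ u, ContinuousMap.toLp 2 (haarProbability G) ℝ v⟫_ℝ =
      ∫ x, u x * v x ∂(haarProbability G) := by
  rw [ContinuousMap.inner_toLp]
  refine integral_congr_ae (Eventually.of_forall fun x => ?_)
  simp [mul_comm]

/-- **`T_k` is symmetric** on `L²(G)` for a continuous symmetric kernel (`k(g⁻¹) = k(g)`):
`⟪T_k f, g⟫ = ⟪f, T_k g⟫`. Both sides are continuous in `(f, g)` and agree on the dense subspace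
of continuous functions by `integral_haarConv_mul_eq`. [folklore] -/
theorem convL2_isSymmetric [T2Space G] {k : G → ℝ} (hk : Continuous k) (hks : ∀ y, k y⁻¹ = k y) :
    (convL2 (G := G) hk : Lp ℝ 2 (haarProbability G) →ₗ[ℝ] Lp ℝ 2 (haarProbability G)).IsSymmetric := by
  intro f g
  simp only [ContinuousLinearMap.coe_coe]
  -- the two continuous functions of `(f, g)`
  set Φ : Lp ℝ 2 (haarProbability G) × Lp ℝ 2 (haarProbability G) → ℝ :=
    fun z => ⟪convL2 hk z.1, z.2⟫_ℝ with hΦ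
  set Ψ : Lp ℝ 2 (haarProbability G) × Lp ℝ 2 (haarProbability G) → ℝ :=
    fun z => ⟪z.1, convL2 hk z.2⟫_ℝ with hΨ
  have hΦc : Continuous Φ :=
    Continuous.inner ((convL2 hk).continuous.comp continuous_fst) continuous_snd
  have hΨc : Continuous Ψ :=
    Continuous.inner continuous_fst ((convL2 hk).continuous.comp continuous_snd)
  have hd : DenseRange (Prod.map (ContinuousMap.toLp 2 (haarProbability G) ℝ : C(G, ℝ) → _)
      (ContinuousMap.toLp 2 (haarProbability G) ℝ : C(G, ℝ) → _)) :=
    denseRange_toLp.prodMap denseRange_toLp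
  have heq : Φ = Ψ := by
    refine Continuous.ext_on hd hΦc hΨc ?_
    rintro _ ⟨⟨u, v⟩, rfl⟩
    simp only [hΦ, hΨ, Prod.map_apply, convL2_toLp, inner_toLp_toLp, ContinuousMap.coe_mk]
    exact integral_haarConv_mul_eq hk hks u.continuous v.continuous
  exact congrFun heq (f, g)

end L2Operator

/-! ### The heat operators on `L²(G)` -/

namespace IsGroupHeatKernel

open scoped InnerProductSpace

variable {p : ℝ → G → ℝ}

/-- The heat operator `T_t = p_t ⋆ ·` on `L²(G)` of a heat kernel `p`, `t > 0`
(Stein 1970, Ch. II §2). [cite: Stein1970, Ch. II §2] -/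
def opL2 (hp : IsGroupHeatKernel p) {t : ℝ} (ht : 0 < t) :
    Lp ℝ 2 (haarProbability G) →L[ℝ] Lp ℝ 2 (haarProbability G) :=
  convL2 (hp.continuous ht)

/-- `T_t` only depends on `t` (not on the positivity witness). [folklore] -/
theorem opL2_congr (hp : IsGroupHeatKernel p) {s t : ℝ} (hs : 0 < s) (ht : 0 < t) (h : s = t) :
    hp.opL2 hs = hp.opL2 ht := by
  subst h; rfl

/-- `T_t (toLp u) = toLp (p_t ⋆ u)` for continuous `u`. [folklore] -/
theorem opL2_toLp (hp : IsGroupHeatKernel p) {t : ℝ} (ht : 0 < t) (u : C(G, ℝ)) :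
    hp.opL2 ht (ContinuousMap.toLp 2 (haarProbability G) ℝ u) =
      ContinuousMap.toLp 2 (haarProbability G) ℝ ⟨haarConv (p t) u,
        QuantumLattice.continuous_haarConv (hp.continuous ht)
          (u.continuous.integrable_of_hasCompactSupport (HasCompactSupport.of_compactSpace _))⟩ :=
  convL2_toLp (hp.continuous ht) u

/-- `T_t` is a compact operator. [folklore] -/
theorem isCompactOperator_opL2 (hp : IsGroupHeatKernel p) {t : ℝ} (ht : 0 < t) :
    IsCompactOperator (hp.opL2 ht) :=
  isCompactOperator_convL2 (hp.continuous ht)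

/-- `T_t` is symmetric: `⟪T_t f, g⟫ = ⟪f, T_t g⟫` (symmetry `p_t(g⁻¹) = p_t(g)`). [folklore] -/
theorem opL2_isSymmetric [T2Space G] (hp : IsGroupHeatKernel p) {t : ℝ} (ht : 0 < t) :
    (hp.opL2 ht : Lp ℝ 2 (haarProbability G) →ₗ[ℝ] Lp ℝ 2 (haarProbability G)).IsSymmetric :=
  convL2_isSymmetric (hp.continuous ht) (hp.symm t ht)

/-- **Semigroup law on `L²`**: `T_s ∘ T_t = T_{s+t}` (both sides are bounded and agree on the
dense subspace of continuous functions by `haarConv_haarConv`). [folklore] -/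
theorem opL2_comp [T2Space G] (hp : IsGroupHeatKernel p) {s t : ℝ} (hs : 0 < s) (ht : 0 < t) :
    (hp.opL2 hs).comp (hp.opL2 ht) = hp.opL2 (add_pos hs ht) := by
  have key : ⇑((hp.opL2 hs).comp (hp.opL2 ht)) = ⇑(hp.opL2 (add_pos hs ht)) := by
    refine denseRange_toLp.equalizer ((hp.opL2 hs).comp (hp.opL2 ht)).continuous
      (hp.opL2 (add_pos hs ht)).continuous ?_
    funext u
    simp only [Function.comp_apply, ContinuousLinearMap.coe_comp, opL2_toLp]
    congr 1
    ext x
    simp only [ContinuousMap.coe_mk]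
    rw [hp.haarConv_haarConv hs ht u.continuous]
  exact ContinuousLinearMap.coeFn_injective key

/-- `T_s (T_t f) = T_{s+t} f`. [folklore] -/
theorem opL2_opL2 [T2Space G] (hp : IsGroupHeatKernel p) {s t : ℝ} (hs : 0 < s) (ht : 0 < t)
    (f : Lp ℝ 2 (haarProbability G)) : hp.opL2 hs (hp.opL2 ht f) = hp.opL2 (add_pos hs ht) f := by
  rw [← hp.opL2_comp hs ht]; rfl

/-- Two heat kernels of the same group give **commuting** operators: `T^p_s T^q_t = T^q_t T^p_s`
(central kernels commute, `haarConv_haarConv_comm`, and density). [folklore] -/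
theorem opL2_comm [T2Space G] {q : ℝ → G → ℝ} (hp : IsGroupHeatKernel p) (hq : IsGroupHeatKernel q)
    {s t : ℝ} (hs : 0 < s) (ht : 0 < t) (f : Lp ℝ 2 (haarProbability G)) :
    hp.opL2 hs (hq.opL2 ht f) = hq.opL2 ht (hp.opL2 hs f) := by
  have key : ⇑((hp.opL2 hs).comp (hq.opL2 ht)) = ⇑((hq.opL2 ht).comp (hp.opL2 hs)) := by
    refine denseRange_toLp.equalizer ((hp.opL2 hs).comp (hq.opL2 ht)).continuous
      ((hq.opL2 ht).comp (hp.opL2 hs)).continuous ?_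
    funext u
    simp only [Function.comp_apply, ContinuousLinearMap.coe_comp, opL2_toLp]
    congr 1
    ext x
    simp only [ContinuousMap.coe_mk]
    rw [hp.haarConv_haarConv_comm hq hs ht u.continuous]
  exact congrFun key f

/-- **Positivity**: `⟪T_t f, f⟫ = ‖T_{t/2} f‖²` (semigroup law and symmetry). [folklore] -/
theorem inner_opL2_self [T2Space G] (hp : IsGroupHeatKernel p) {t : ℝ} (ht : 0 < t)
    (f : Lp ℝ 2 (haarProbability G)) :
    ⟪hp.opL2 ht f, f⟫_ℝ = ‖hp.opL2 (half_pos ht) f‖ ^ 2 := by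
  rw [hp.opL2_congr ht (add_pos (half_pos ht) (half_pos ht)) (add_halves t).symm,
    ← hp.opL2_opL2 (half_pos ht) (half_pos ht) f, ← real_inner_self_eq_norm_sq]
  exact hp.opL2_isSymmetric (half_pos ht) _ _

/-- `⟪T_t f, f⟫ ≥ 0`. [folklore] -/
theorem inner_opL2_self_nonneg [T2Space G] (hp : IsGroupHeatKernel p) {t : ℝ} (ht : 0 < t)
    (f : Lp ℝ 2 (haarProbability G)) : 0 ≤ ⟪hp.opL2 ht f, f⟫_ℝ := by
  rw [hp.inner_opL2_self ht f]; positivity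

/-- If `T_t f = 0` then `T_{t/2} f = 0`. [folklore] -/
theorem opL2_half_eq_zero [T2Space G] (hp : IsGroupHeatKernel p) {t : ℝ} (ht : 0 < t)
    {f : Lp ℝ 2 (haarProbability G)} (h : hp.opL2 ht f = 0) : hp.opL2 (half_pos ht) f = 0 := by
  have := hp.inner_opL2_self ht f
  rw [h, inner_zero_left] at this
  exact norm_eq_zero.mp (pow_eq_zero_iff two_ne_zero |>.mp this.symm)

/-- If `T_t f = 0` then `T_{t/2ⁿ} f = 0` for all `n`. [folklore] -/
theorem opL2_div_pow_eq_zero [T2Space G] (hp : IsGroupHeatKernel p) {t : ℝ} (ht : 0 < t)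
    {f : Lp ℝ 2 (haarProbability G)} (h : hp.opL2 ht f = 0) (n : ℕ) :
    hp.opL2 (show 0 < t / 2 ^ n by positivity) f = 0 := by
  induction n with
  | zero => rw [hp.opL2_congr _ ht (by simp)]; exact h
  | succ n ih =>
      have h2 := hp.opL2_half_eq_zero (show 0 < t / 2 ^ n by positivity) ih
      rw [hp.opL2_congr _ (half_pos (show 0 < t / 2 ^ n by positivity))
        (by rw [pow_succ]; ring)]
      exact h2

/-- **Approximate identity in `L²` along a sequence**: if `t_n → 0⁺` then
`T_{t_n} (toLp u) → toLp u` for continuous `u` (uniform convergence `p_t ⋆ u → u`). [folklore] -/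
theorem tendsto_opL2_toLp (hp : IsGroupHeatKernel p) {s : ℕ → ℝ} (hs : ∀ n, 0 < s n)
    (hs0 : Tendsto s atTop (𝓝 0)) (u : C(G, ℝ)) :
    Tendsto (fun n => hp.opL2 (hs n) (ContinuousMap.toLp 2 (haarProbability G) ℝ u)) atTop
      (𝓝 (ContinuousMap.toLp 2 (haarProbability G) ℝ u)) := by
  simp only [opL2_toLp]
  refine ((ContinuousMap.toLp 2 (haarProbability G) ℝ).continuous.tendsto u).comp ?_
  rw [ContinuousMap.tendsto_iff_tendstoUniformly, Metric.tendstoUniformly_iff]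
  intro ε hε
  have hs' : Tendsto s atTop (𝓝[>] 0) :=
    tendsto_nhdsWithin_of_tendsto_nhds_of_eventually_within s hs0 (Eventually.of_forall hs)
  filter_upwards [hs'.eventually (hp.eventually_forall_abs_haarConv_sub_lt u hε)] with n hn x
  rw [Real.dist_eq, abs_sub_comm]
  exact hn x

/-- **Injectivity of the heat operators on `L²`.** If `T_t f = 0` then `T_{t/2ⁿ} f = 0` for all
`n`, hence `⟪f, u⟫ = lim ⟪f, T_{t/2ⁿ} u⟫ = lim ⟪T_{t/2ⁿ} f, u⟫ = 0` for every continuous `u`, and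
continuous functions are dense. [folklore] -/
theorem opL2_injective [T2Space G] (hp : IsGroupHeatKernel p) {t : ℝ} (ht : 0 < t) :
    Function.Injective (hp.opL2 ht) := by
  refine (injective_iff_map_eq_zero _).mpr fun f hf => ?_
  -- `f` is orthogonal to every continuous function
  have horth : ∀ u : C(G, ℝ), ⟪f, ContinuousMap.toLp 2 (haarProbability G) ℝ u⟫_ℝ = 0 := by
    intro u
    have hs : ∀ n : ℕ, 0 < t / 2 ^ n := fun n => by positivity
    have hs0 : Tendsto (fun n : ℕ => t / 2 ^ n) atTop (𝓝 0) := by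
      simpa [div_eq_mul_inv] using (tendsto_pow_atTop_nhds_zero_of_lt_one (r := (2 : ℝ)⁻¹)
        (by positivity) (by norm_num)).const_mul t
    have hlim := (tendsto_const_nhds (x := f)).inner (𝕜 := ℝ) (hp.tendsto_opL2_toLp hs hs0 u)
    have hzero : ∀ n, ⟪f, hp.opL2 (hs n) (ContinuousMap.toLp 2 (haarProbability G) ℝ u)⟫_ℝ = 0 := by
      intro n
      have hsym := hp.opL2_isSymmetric (hs n) f (ContinuousMap.toLp 2 (haarProbability G) ℝ u)
      simp only [ContinuousLinearMap.coe_coe] at hsym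
      rw [← hsym, hp.opL2_div_pow_eq_zero ht hf n, inner_zero_left]
    simp only [hzero] at hlim
    exact tendsto_nhds_unique tendsto_const_nhds hlim |>.symm
  -- hence to everything, in particular to itself
  have hall : ∀ g : Lp ℝ 2 (haarProbability G), ⟪f, g⟫_ℝ = 0 := by
    intro g
    have hc : Continuous fun g : Lp ℝ 2 (haarProbability G) => ⟪f, g⟫_ℝ :=
      continuous_const.inner continuous_id
    have := congrFun (denseRange_toLp.equalizer hc continuous_const (funext fun u => horth u)) g
    simpa using this
  exact inner_self_eq_zero.mp (hall f)

/-- An eigenvector of `T_t` with non-zero eigenvalue has a continuous representative, namely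
`λ⁻¹ (p_t ⋆ f)`. [folklore] -/
theorem exists_toLp_eq_of_eigen (hp : IsGroupHeatKernel p) {t : ℝ} (ht : 0 < t) {c : ℝ} (hc : c ≠ 0)
    {f : Lp ℝ 2 (haarProbability G)} (hf : hp.opL2 ht f = c • f) :
    ∃ u : C(G, ℝ), ContinuousMap.toLp 2 (haarProbability G) ℝ u = f ∧
      ∀ x, u x = c⁻¹ * haarConv (p t) f x := by
  refine ⟨c⁻¹ • convToCM (hp.continuous ht) f, ?_, fun x => rfl⟩
  rw [map_smul]
  change c⁻¹ • hp.opL2 ht f = f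
  rw [hf, smul_smul, inv_mul_cancel₀ hc, one_smul]

end IsGroupHeatKernel



/-! ### Spectral structure: eigenspaces of the heat operators -/

namespace IsGroupHeatKernel

open scoped InnerProductSpace

variable {p : ℝ → G → ℝ}

/-- The eigenspace `E_c = {f ∈ L² | T_1 f = c f}` of the time-one heat operator. [folklore] -/
abbrev eig (hp : IsGroupHeatKernel p) (c : ℝ) : Submodule ℝ (Lp ℝ 2 (haarProbability G)) :=
  Module.End.eigenspace
    ((hp.opL2 one_pos : Lp ℝ 2 (haarProbability G) →L[ℝ] Lp ℝ 2 (haarProbability G)) :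
      Module.End ℝ (Lp ℝ 2 (haarProbability G))) c

/-- Membership in `E_c`: `T_1 f = c f`. [folklore] -/
theorem mem_eig_iff (hp : IsGroupHeatKernel p) {c : ℝ} {f : Lp ℝ 2 (haarProbability G)} :
    f ∈ hp.eig c ↔ hp.opL2 one_pos f = c • f := by
  rw [eig, Module.End.mem_eigenspace_iff]; rfl

/-- `E_0 = ⊥`: the time-one heat operator is injective. [folklore] -/
theorem eig_zero [T2Space G] (hp : IsGroupHeatKernel p) : hp.eig 0 = ⊥ := by
  rw [Submodule.eq_bot_iff]
  intro f hf
  rw [mem_eig_iff, zero_smul] at hf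
  exact (injective_iff_map_eq_zero _).mp (hp.opL2_injective one_pos) f hf

/-- **Eigenvalues of the heat operator are positive**: if `E_c ≠ ⊥` then `0 < c`
(`⟪T_1 f, f⟫ = ‖T_{1/2} f‖² > 0` for `f ≠ 0`, by injectivity of `T_{1/2}`). [folklore] -/
theorem eigenvalue_pos [T2Space G] (hp : IsGroupHeatKernel p) {c : ℝ}
    {f : Lp ℝ 2 (haarProbability G)} (hf : f ∈ hp.eig c) (hf0 : f ≠ 0) : 0 < c := by
  rw [mem_eig_iff] at hf
  have h1 := hp.inner_opL2_self one_pos f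
  rw [hf, real_inner_smul_left, real_inner_self_eq_norm_sq] at h1
  have hpos : 0 < ‖hp.opL2 (half_pos one_pos) f‖ ^ 2 := by
    have : hp.opL2 (half_pos one_pos) f ≠ 0 := fun h =>
      hf0 ((injective_iff_map_eq_zero _).mp (hp.opL2_injective (half_pos one_pos)) f h)
    positivity
  have hf2 : 0 < ‖f‖ ^ 2 := by positivity
  rw [← h1] at hpos
  exact pos_of_mul_pos_left hpos hf2.le

/-- Eigenspaces of the heat operator for non-zero eigenvalues are finite-dimensional
(compact self-adjoint operator; Mathlib `ContinuousLinearMap.finite_dimensional_eigenspace`).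
[folklore] -/
instance finiteDimensional_eig (hp : IsGroupHeatKernel p) (c : ℝ) [NeZero c] :
    FiniteDimensional ℝ (hp.eig c) :=
  ContinuousLinearMap.finite_dimensional_eigenspace (hp.isCompactOperator_opL2 one_pos) c
    (NeZero.ne c)

/-- **The eigenfunctions of the heat operator span a dense subspace of `L²(G)`** (spectral
theorem for the compact self-adjoint operator `T_1`,
`ContinuousLinearMap.orthogonalComplement_iSup_eigenspaces_eq_bot`). [folklore] -/
theorem iSup_eig_dense [T2Space G] (hp : IsGroupHeatKernel p) :
    (⨆ c, hp.eig c).topologicalClosure = ⊤ :=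
  Submodule.topologicalClosure_eq_top_iff.mpr
    (ContinuousLinearMap.orthogonalComplement_iSup_eigenspaces_eq_bot
      (hp.isCompactOperator_opL2 one_pos) (hp.opL2_isSymmetric one_pos))

/-- The heat operators of any heat kernel `q` of `G` preserve the eigenspaces `E_c` of `p`
(the operators commute, `opL2_comm`). [folklore] -/
theorem opL2_mem_eig [T2Space G] {q : ℝ → G → ℝ} (hp : IsGroupHeatKernel p)
    (hq : IsGroupHeatKernel q) {s : ℝ} (hs : 0 < s) {c : ℝ} {f : Lp ℝ 2 (haarProbability G)}
    (hf : f ∈ hp.eig c) : hq.opL2 hs f ∈ hp.eig c := by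
  rw [mem_eig_iff] at hf ⊢
  rw [hp.opL2_comm hq one_pos hs, hf, map_smul]

/-- **Uniqueness of positive square roots on an eigenspace.** If `T_s = r² · id` on `E_c` with
`r > 0`, then `T_{s/2} = r · id` on `E_c`: for `w = T_{s/2} f - r f ∈ E_c` one has
`(T_{s/2} + r) w = T_s f - r² f = 0`, while `⟪(T_{s/2} + r) w, w⟫ ≥ r ‖w‖²`. [folklore] -/
theorem opL2_half_eq_smul [T2Space G] (hp : IsGroupHeatKernel p) {c s r : ℝ} (hs : 0 < s)
    (hr : 0 < r) (H : ∀ f ∈ hp.eig c, hp.opL2 hs f = (r ^ 2) • f)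
    {f : Lp ℝ 2 (haarProbability G)} (hf : f ∈ hp.eig c) :
    hp.opL2 (half_pos hs) f = r • f := by
  set B := hp.opL2 (half_pos hs) with hB
  set w := B f - r • f with hw
  have hwE : w ∈ hp.eig c := (hp.eig c).sub_mem (hp.opL2_mem_eig hp _ hf) ((hp.eig c).smul_mem r hf)
  have hBB : ∀ g, B (B g) = hp.opL2 hs g := fun g => by
    rw [hB, hp.opL2_opL2, hp.opL2_congr _ hs (add_halves s)]
  have hkill : B w + r • w = 0 := by
    rw [hw, map_sub, map_smul, hBB, H f hf, smul_sub, smul_smul, ← pow_two]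
    abel
  have hinner : ⟪B w + r • w, w⟫_ℝ = ⟪B w, w⟫_ℝ + r * ‖w‖ ^ 2 := by
    rw [inner_add_left, real_inner_smul_left, real_inner_self_eq_norm_sq]
  rw [hkill, inner_zero_left] at hinner
  have hBw : 0 ≤ ⟪B w, w⟫_ℝ := hp.inner_opL2_self_nonneg _ w
  have hw0 : ‖w‖ ^ 2 = 0 := by nlinarith [sq_nonneg ‖w‖]
  have : w = 0 := by simpa using hw0
  rw [hw, sub_eq_zero] at this
  exact this

/-- On `E_c` (`c > 0`), `T_{2⁻ⁿ} = c^{2⁻ⁿ} · id`. [folklore] -/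
theorem opL2_inv_two_pow_eq_smul [T2Space G] (hp : IsGroupHeatKernel p) {c : ℝ} (hc : 0 < c)
    (n : ℕ) {f : Lp ℝ 2 (haarProbability G)} (hf : f ∈ hp.eig c) :
    hp.opL2 (show (0 : ℝ) < 1 / 2 ^ n by positivity) f = (c ^ ((1 : ℝ) / 2 ^ n)) • f := by
  induction n generalizing f with
  | zero =>
      rw [hp.opL2_congr _ one_pos (by simp)]
      simpa [Real.rpow_one] using (hp.mem_eig_iff.mp hf)
  | succ n ih =>
      have hs : (0 : ℝ) < 1 / 2 ^ n := by positivity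
      have hr : 0 < c ^ ((1 : ℝ) / 2 ^ (n + 1)) := Real.rpow_pos_of_pos hc _
      have hsq : (c ^ ((1 : ℝ) / 2 ^ (n + 1))) ^ 2 = c ^ ((1 : ℝ) / 2 ^ n) := by
        rw [sq, ← Real.rpow_add hc]
        congr 1
        field_simp
        ring
      have H : ∀ g ∈ hp.eig c, hp.opL2 hs g = (c ^ ((1 : ℝ) / 2 ^ (n + 1))) ^ 2 • g := by
        intro g hg
        rw [hsq]
        exact ih hg
      have := hp.opL2_half_eq_smul hs hr H hf
      rw [hp.opL2_congr _ (half_pos hs) (by rw [pow_succ]; ring)]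
      exact this

/-- On `E_c` (`c > 0`), `T_{m/2ⁿ} = c^{m/2ⁿ} · id` for `m ≥ 1`. [folklore] -/
theorem opL2_dyadic_eq_smul [T2Space G] (hp : IsGroupHeatKernel p) {c : ℝ} (hc : 0 < c)
    (n m : ℕ) (hm : 0 < m) {f : Lp ℝ 2 (haarProbability G)} (hf : f ∈ hp.eig c) :
    hp.opL2 (show (0 : ℝ) < m / 2 ^ n by positivity) f = (c ^ ((m : ℝ) / 2 ^ n)) • f := by
  induction m, hm using Nat.le_induction generalizing f with
  | base => simpa using hp.opL2_inv_two_pow_eq_smul hc n hf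
  | succ m hm ih =>
      have h1 : (0 : ℝ) < 1 / 2 ^ n := by positivity
      have hm' : (0 : ℝ) < m / 2 ^ n := by positivity
      rw [hp.opL2_congr _ (add_pos h1 hm') (by push_cast; ring), ← hp.opL2_opL2 h1 hm', ih hf,
        map_smul, hp.opL2_inv_two_pow_eq_smul hc n hf, smul_smul, ← Real.rpow_add hc]
      congr 2
      push_cast; ring

/-- Dyadic approximation from above: for `t ≥ 0`, `d_k = (⌊t 2ᵏ⌋ + 1)/2ᵏ` satisfies
`t < d_k ≤ t + 2⁻ᵏ`, hence `d_k → t`. [folklore] -/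
theorem tendsto_dyadic_above {t : ℝ} (ht : 0 ≤ t) :
    Tendsto (fun k : ℕ => ((⌊t * 2 ^ k⌋₊ + 1 : ℕ) : ℝ) / 2 ^ k) atTop (𝓝 t) := by
  have hup : Tendsto (fun k : ℕ => t + 1 / 2 ^ k) atTop (𝓝 t) := by
    have h0 : Tendsto (fun k : ℕ => (1 : ℝ) / 2 ^ k) atTop (𝓝 0) := by
      simpa [div_eq_mul_inv] using tendsto_pow_atTop_nhds_zero_of_lt_one (r := (2 : ℝ)⁻¹)
        (by positivity) (by norm_num)
    simpa using h0.const_add t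
  refine tendsto_of_tendsto_of_tendsto_of_le_of_le tendsto_const_nhds hup (fun k => ?_) (fun k => ?_)
  · have h2 : (0 : ℝ) < 2 ^ k := by positivity
    rw [le_div_iff₀ h2]
    push_cast
    exact (Nat.lt_floor_add_one (t * 2 ^ k)).le
  · have h2 : (0 : ℝ) < 2 ^ k := by positivity
    rw [div_le_iff₀ h2]
    push_cast
    have := Nat.floor_le (mul_nonneg ht h2.le)
    rw [add_mul, one_div, inv_mul_cancel₀ h2.ne']
    linarith

/-- `t < (⌊t 2ᵏ⌋ + 1)/2ᵏ`. [folklore] -/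
theorem lt_dyadic_above (t : ℝ) (k : ℕ) : t < ((⌊t * 2 ^ k⌋₊ + 1 : ℕ) : ℝ) / 2 ^ k := by
  have h2 : (0 : ℝ) < 2 ^ k := by positivity
  rw [lt_div_iff₀ h2]
  push_cast
  exact Nat.lt_floor_add_one (t * 2 ^ k)

/-- **`T_t = c^t · id` on `E_c` for all `t > 0`** (`c > 0`): dyadic times by
`opL2_dyadic_eq_smul`, general `t` by approximation from above with dyadics `d_k ↓ t`, using
`T_{d_k} f = T_t (T_{d_k - t} f) → T_t f` (approximate identity, `f` has a continuous
representative) and `c^{d_k} → c^t`. [folklore] -/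
theorem opL2_eq_smul_of_mem_eig [T2Space G] (hp : IsGroupHeatKernel p) {c : ℝ} (hc : 0 < c)
    {t : ℝ} (ht : 0 < t) {f : Lp ℝ 2 (haarProbability G)} (hf : f ∈ hp.eig c) :
    hp.opL2 ht f = (c ^ t) • f := by
  obtain ⟨u, hu, -⟩ := hp.exists_toLp_eq_of_eigen one_pos hc.ne' (hp.mem_eig_iff.mp hf)
  set d : ℕ → ℝ := fun k => ((⌊t * 2 ^ k⌋₊ + 1 : ℕ) : ℝ) / 2 ^ k with hd
  have hd_gt : ∀ k, t < d k := fun k => lt_dyadic_above t k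
  have hd_pos : ∀ k, 0 < d k := fun k => ht.trans (hd_gt k)
  have hd_lim : Tendsto d atTop (𝓝 t) := tendsto_dyadic_above ht.le
  have hs_pos : ∀ k, 0 < d k - t := fun k => sub_pos.mpr (hd_gt k)
  have hs_lim : Tendsto (fun k => d k - t) atTop (𝓝 0) := by
    simpa using hd_lim.sub_const t
  -- `T_{d k} f = c^{d k} f`
  have h1 : ∀ k, hp.opL2 (hd_pos k) f = (c ^ d k) • f := fun k =>
    hp.opL2_dyadic_eq_smul hc k _ (Nat.succ_pos _) hf
  -- `T_{d k} f = T_t (T_{d k - t} f)`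
  have h2 : ∀ k, hp.opL2 (hd_pos k) f = hp.opL2 ht (hp.opL2 (hs_pos k) f) := fun k => by
    rw [hp.opL2_opL2, hp.opL2_congr (hd_pos k) (add_pos ht (hs_pos k)) (by ring)]
  have hlimA : Tendsto (fun k => hp.opL2 ht (hp.opL2 (hs_pos k) f)) atTop (𝓝 (hp.opL2 ht f)) := by
    have h := hp.tendsto_opL2_toLp hs_pos hs_lim u
    rw [hu] at h
    exact ((hp.opL2 ht).continuous.tendsto f).comp h
  have hlimB : Tendsto (fun k => (c ^ d k) • f) atTop (𝓝 ((c ^ t) • f)) :=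
    (((Real.continuous_const_rpow hc.ne').tendsto t).comp hd_lim).smul_const f
  have heq : (fun k => hp.opL2 ht (hp.opL2 (hs_pos k) f)) = fun k => (c ^ d k) • f :=
    funext fun k => by rw [← h2 k, h1 k]
  rw [heq] at hlimA
  exact tendsto_nhds_unique hlimA hlimB

/-- **Joint eigenspaces.** For another heat kernel `q` of `G` and `c ≠ 0`, the eigenspace `E_c`
of `p` is spanned by joint eigenvectors: `E_c ≤ ⨆_d (E_c ⊓ E^q_d)` (the symmetric operator
`T^q_1` preserves the finite-dimensional space `E_c` and is diagonalisable there). [folklore] -/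
theorem eig_le_iSup_inf_eig [T2Space G] {q : ℝ → G → ℝ} (hp : IsGroupHeatKernel p)
    (hq : IsGroupHeatKernel q) {c : ℝ} (hc : c ≠ 0) :
    hp.eig c ≤ ⨆ d, (hp.eig c ⊓ hq.eig d) := by
  haveI : NeZero c := ⟨hc⟩
  intro f hf
  have hinv : ∀ v ∈ hp.eig c, ((hq.opL2 one_pos : Lp ℝ 2 (haarProbability G) →L[ℝ]
      Lp ℝ 2 (haarProbability G)) : Lp ℝ 2 (haarProbability G) →ₗ[ℝ] Lp ℝ 2 (haarProbability G))
        v ∈ hp.eig c :=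
    fun v hv => hp.opL2_mem_eig hq one_pos hv
  set Q := ((hq.opL2 one_pos : Lp ℝ 2 (haarProbability G) →L[ℝ] Lp ℝ 2 (haarProbability G)) :
    Lp ℝ 2 (haarProbability G) →ₗ[ℝ] Lp ℝ 2 (haarProbability G)).restrict hinv with hQ
  have hQs : Q.IsSymmetric := (hq.opL2_isSymmetric one_pos).restrict_invariant hinv
  have horth : (⨆ d, Module.End.eigenspace Q d)ᗮ = ⊥ :=
    hQs.orthogonalComplement_iSup_eigenspaces_eq_bot
  have htop : (⨆ d, Module.End.eigenspace Q d) = ⊤ :=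
    Submodule.orthogonal_eq_bot_iff.mp horth
  have hmem : (⟨f, hf⟩ : hp.eig c) ∈ ⨆ d, Module.End.eigenspace Q d := by
    rw [htop]; exact Submodule.mem_top
  have hmap := Submodule.mem_map_of_mem (f := (hp.eig c).subtype) hmem
  rw [Submodule.map_iSup] at hmap
  have hle : (⨆ d, Submodule.map (hp.eig c).subtype (Module.End.eigenspace Q d)) ≤
      ⨆ d, (hp.eig c ⊓ hq.eig d) := by
    refine iSup_mono fun d => ?_
    rintro _ ⟨v, hv, rfl⟩
    refine ⟨v.2, ?_⟩
    have hv' : Q v = d • v := Module.End.mem_eigenspace_iff.mp hv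
    have hv'' := congrArg Subtype.val hv'
    simp only [hQ, LinearMap.coe_restrict_apply, Submodule.coe_smul] at hv''
    change (v : Lp ℝ 2 (haarProbability G)) ∈ hq.eig d
    rw [hq.mem_eig_iff]
    exact hv''
  exact hle hmap

/-- The joint eigenvectors of the heat operators of two heat kernels `p`, `q` of `G` span a
dense subspace of `L²(G)`. [folklore] -/
theorem iSup_inf_eig_dense [T2Space G] {q : ℝ → G → ℝ} (hp : IsGroupHeatKernel p)
    (hq : IsGroupHeatKernel q) :
    (⨆ c, ⨆ d, (hp.eig c ⊓ hq.eig d)).topologicalClosure = ⊤ := by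
  have hle : (⨆ c, hp.eig c) ≤ ⨆ c, ⨆ d, (hp.eig c ⊓ hq.eig d) := by
    refine iSup_le fun c => ?_
    by_cases hc : c = 0
    · subst hc; rw [hp.eig_zero]; exact bot_le
    · exact (hp.eig_le_iSup_inf_eig hq hc).trans
        (le_iSup (fun c => ⨆ d, (hp.eig c ⊓ hq.eig d)) c)
  exact eq_top_iff.mpr (hp.iSup_eig_dense ▸ Submodule.topologicalClosure_mono hle)

/-- On a non-trivial joint eigenspace `E^p_c ⊓ E^q_d` both eigenvalues are positive and the
operators act by `T^p_t = c^t`, `T^q_s = d^s`. [folklore] -/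
theorem opL2_eq_smul_of_mem_inf_eig [T2Space G] {q : ℝ → G → ℝ} (hp : IsGroupHeatKernel p)
    (hq : IsGroupHeatKernel q) {c d : ℝ} {f : Lp ℝ 2 (haarProbability G)}
    (hf : f ∈ hp.eig c ⊓ hq.eig d) (hf0 : f ≠ 0) {t s : ℝ} (ht : 0 < t) (hs : 0 < s) :
    0 < c ∧ 0 < d ∧ hp.opL2 ht f = (c ^ t) • f ∧ hq.opL2 hs f = (d ^ s) • f :=
  ⟨hp.eigenvalue_pos hf.1 hf0, hq.eigenvalue_pos hf.2 hf0,
    hp.opL2_eq_smul_of_mem_eig (hp.eigenvalue_pos hf.1 hf0) ht hf.1,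
    hq.opL2_eq_smul_of_mem_eig (hq.eigenvalue_pos hf.2 hf0) hs hf.2⟩

end IsGroupHeatKernel

end Literature.MathematicalPhysics.QuantumLattice
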